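import Mathlib.MeasureTheory.Integral.Bochner.Basic
import Mathlib.MeasureTheory.Measure.Lebesgue.Complex
import Mathlib.Algebra.BigOperators.Finprod
import Mathlib.Analysis.SpecialFunctions.Trigonometric.Basic
import Literature.Probability.RandomPlanarGeometry.LoopWinding
import HarnessLib

/-!
# The `cos_μ`-twisted nesting transform of a full-plane loop-configuration law (`μ = 1/6`)

The continuum object behind the "magic formula" of Duminil-Copin–Kozlowski–Lammers–Manolescu
(arXiv:2603.06268, §3.2 and Cor. 10): for a loop ensemble `𝓛` in the plane and a test density
`f : ℂ → ℝ` (bounded, compactly supported, `∫ f = 0`) the loop functional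
`A_f(𝓛) = ∏_{ℓ ∈ 𝓛} cos_μ(f(int ℓ))` (their (5.4), p. 38, "whenever the infinite product is
well-defined"), with `f(int ℓ) = ∫_{int ℓ} f`, `cos_μ(x) = cos(x + 2πμ)/cos(2πμ)` and, at
the percolation point `q = 1`, `μ = 1/6`, `cos_μ(x) = 2 cos(x + π/3)` (§3.2, display before
Cor. 10); and its expectation `Λ_P(f) = E_P[A_f]`, the **nesting transform** of the law `P`.
On a lattice configuration the product is finite. For a continuum law (a subsequential
scaling limit, a CLE) infinitely many loops cut the support of `f`, and the product is
defined — as the authors do when they "restrict to large loops" (§5, p. 37: the loops counted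
are those *not* contained in a ball of radius `ε`, at a cost `O(ε^c)`) and as
Miller–Watson–Wilson define the CLE nesting field (PTRF 163 (2015), Thm. 1.1: count the loops
surrounding `B(z, ε)`, then let `ε → 0`) — through the **`ε`-truncation to loops of diameter
`≥ ε`** followed by the limit `ε → 0⁺`:

  `Λ_P(f) := lim_{ε → 0⁺} E_P[ ∏_{u : diam(u) ≥ ε} 2 cos(∫_{int u} f + π/3) ]`.

The existence of this limit is a THEOREM about `P` (for CLE-type laws), never part of the
definition: the value is `limUnder` of the truncated expectations and the convergence is the
separate predicate `HasNestingTransform`.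

## Contents (namespace `Literature.Probability.RandomPlanarGeometry`)

* `UnbasedLoop.nestingPhase f u = ∫_{z : W(u,z) ≠ 0} f z` — the `f`-mass of the interior of
  the loop `u`, the interior being the points of non-zero winding number (`UnbasedLoop.wind`,
  file `LoopWinding`; an open, hence Borel, set — `UnbasedLoop.isOpen_setOf_wind_ne_zero` in
  `Literature.Probability.Percolation.FKLoopNestingDensityLimit`); independent of the
  orientation (`nestingPhase_reverse`).
* `UnbasedLoop.nestingFactor f u = 2 cos(nestingPhase f u + π/3)` — the loop weight `cos_μ`,
  `μ = 1/6`; `= 1` when the phase vanishes (`nestingFactor_eq_one_of_nestingPhase_eq_zero`),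
  which is why only loops whose interior splits the support of `f` contribute; `|·| ≤ 2`.
* `LoopConfig.loops c = c.F 0 ∪ c.F 1` (both types of DKKMO's typed configurations) and
  `LoopConfig.bigLoops ε c = {u ∈ c.loops | ε ≤ diam (range u)}`; `bigLoops ε c = c.loops`
  for `ε ≤ 0`; antitone in `ε`.
* `LoopConfig.truncNestingWeight f ε c = ∏ᶠ u ∈ c.bigLoops ε, nestingFactor f u` (a `finprod`:
  the honest product when finitely many factors differ from `1`, junk `1` otherwise) and the
  untruncated `LoopConfig.nestingWeight f c = ∏ᶠ u ∈ c.loops, nestingFactor f u`, which is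
  literally the lattice functional typed in the consumer route (`nestingWeight_eq_finprod`:
  `∏ᶠ u ∈ c.F 0 ∪ c.F 1, 2 cos((∫ z in {z | u.wind z ≠ 0}, f z) + π/3)`).
* For a random configuration `X : Ω → LoopConfig ℂ` under a measure `P` on `Ω` (the pair
  `(P, X)` is "the law", exactly as in `LoopConfig.cnLawEDist`; a law `P` on a measurable space
  of configurations is the case `X =` the inclusion into `LoopConfig ℂ`):
  `truncNestingTransform P X f ε = ∫ ω, truncNestingWeight f ε (X ω) ∂P`,
  `HasNestingTransform P X f Λ :↔ Tendsto (truncNestingTransform P X f) (𝓝[>] 0) (𝓝 Λ)`,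
  `nestingTransform P X f = limUnder (𝓝[>] 0) (truncNestingTransform P X f)`;
  `HasNestingTransform.nestingTransform_eq`, uniqueness, and the **lattice consistency**
  `hasNestingTransform_of_le_diam`: if every loop of every `X ω` has diameter `≥ ε₀ > 0` (any
  lattice loop representation at positive mesh) then the limit exists and equals the
  untruncated expectation `∫ ω, nestingWeight f (X ω) ∂P` (`= truncNestingTransform P X f 0`).

## Design notes

* Test functions are densities `f : ℂ → ℝ` against Lebesgue measure on `ℂ`, as in the consumer
  route; DKLM's generalised test functions (finite compactly supported signed measures of mass
  zero, Def. 5) enter the lattice fact `Literature.Probability.Percolation.dklm2026_corollary10`,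
  whose density form is `dklm2026_corollary10.density_one`. Boundedness, compact support and
  `∫ f = 0` are hypotheses of theorems about the transform, not arguments of the definition.
* Only `μ = 1/6` (`q = 1`, percolation / CLE₆) is defined here, with the weight written out as
  `2 cos(· + π/3)` so that the file stays inside `RandomPlanarGeometry` (the `q`-dependent
  `cosMu q` lives in `Literature.Probability.Percolation.FKLoopNestingGaussianLimit`, and
  `cosMu_one : cosMu 1 x = 2 cos(x + π/3)` identifies the two).
* Truncation by the diameter of the trace (`Metric.diam u.range`) is the configuration-level,
  point-free form of the two printed devices (a loop surrounding `B(z, ε)` has diameter `≥ ε`;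
  a loop of diameter `< ε` through a point lies in the closed `ε`-ball about it). No
  renormalisation in `ε` is built in: DKLM assert that for the scaling limits of the critical
  FK loops `A_f` is a.s. well defined and integrable and that small loops cost `O(ε^c)` (§5,
  pp. 37–38); whether a given `P` needs none is exactly the content of `HasNestingTransform`.
* Deliberately NOT here: any σ-algebra/topology on configurations (the sibling request
  `LocFinLoopConfig`), measurability or integrability of the weights, existence of the limit
  for any continuum law, and the Gaussian value `exp((3/4π²) ∬ log|x-y| f(x) f(y))`
  (a statement about specific laws).

## References

* H. Duminil-Copin, K. K. Kozlowski, P. Lammers, I. Manolescu, *Gaussian free field convergence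
  of the six-vertex model with `-1 ≤ Δ ≤ -1/2`*, arXiv:2603.06268 (2026): §3.2 (display before
  Cor. 10: `μ`, `cos_μ`, `int(ℓ)`), Cor. 10 (p. 13), §5 p. 37 ("restrict to large loops",
  `O(ε^c)`), (5.4) p. 38 (`A_φ(𝓛)`). [DuminilCopinKozlowskiLammersManolescu2026]
* J. Miller, S. S. Watson, D. B. Wilson, *The conformal loop ensemble nesting field*, Probab.
  Theory Related Fields 163 (2015), Thm. 1.1 (`ε`-ball nesting count, limit `ε → 0`).
  [MillerWatsonWilson2015]
* H. Duminil-Copin, K. K. Kozlowski, D. Krachun, I. Manolescu, M. Oulamara, arXiv:2012.11672v2,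
  §1.2 (typed loop configurations `F = F₀ ⊔ F₁`). [arXiv201211672v2]
-/

noncomputable section

open Set Filter
open _root_.MeasureTheory
open scoped Real
open scoped _root_.Topology

namespace Literature.Probability.RandomPlanarGeometry

/-! ### The loop weight `cos_μ(∫_{int u} f)`, `μ = 1/6` -/

namespace UnbasedLoop

/-- **The `f`-mass of the interior of a planar loop**, `f(int u) = ∫_{int u} f(z) dz`, where the
interior `int u` is the set of points of non-zero winding number `{z | W(u, z) ≠ 0}` (for a
simple loop: the bounded complementary component, DKLM §3.2; the winding number is `0` on the
trace by convention). Bochner integral against Lebesgue measure on `ℂ` (junk `0` if `f` is not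
integrable there). [cite: DuminilCopinKozlowskiLammersManolescu2026, §3.2] -/
def nestingPhase (f : ℂ → ℝ) (u : UnbasedLoop ℂ) : ℝ := ∫ z in {z | u.wind z ≠ 0}, f z

/-- The interior `{W ≠ 0}`, hence the phase, does not depend on the orientation of the loop
(time reversal negates the winding number). [folklore] -/
theorem setOf_wind_reverse_ne_zero (u : UnbasedLoop ℂ) :
    {z | u.reverse.wind z ≠ 0} = {z | u.wind z ≠ 0} := by
  ext z
  simp only [mem_setOf_eq, wind_reverse, ne_eq, neg_eq_zero]

/-- `nestingPhase f u.reverse = nestingPhase f u`. [folklore] -/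
@[simp] theorem nestingPhase_reverse (f : ℂ → ℝ) (u : UnbasedLoop ℂ) :
    u.reverse.nestingPhase f = u.nestingPhase f := by
  rw [nestingPhase, nestingPhase, setOf_wind_reverse_ne_zero]

/-- The phase of the zero density vanishes. [folklore] -/
@[simp] theorem nestingPhase_zero (u : UnbasedLoop ℂ) : u.nestingPhase 0 = 0 := by
  simp [nestingPhase]

/-- **The twisted loop weight `cos_μ(f(int u))` at `μ = 1/6`**:
`cos_μ(x) = cos(x + 2πμ)/cos(2πμ) = 2 cos(x + π/3)` for `μ = arccos(√q/2)/2π = 1/6` at `q = 1`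
(DKLM §3.2, display before Cor. 10; the percolation case of the BKW loop weight).
[cite: DuminilCopinKozlowskiLammersManolescu2026, §3.2] -/
def nestingFactor (f : ℂ → ℝ) (u : UnbasedLoop ℂ) : ℝ := 2 * Real.cos (u.nestingPhase f + π / 3)

/-- Unfolding `nestingFactor` down to the winding-number interior (the shape typed in the
consumer route `CardyMagicRigidity`). [cite: DuminilCopinKozlowskiLammersManolescu2026, §3.2] -/
theorem nestingFactor_eq (f : ℂ → ℝ) (u : UnbasedLoop ℂ) :
    u.nestingFactor f = 2 * Real.cos ((∫ z in {z | u.wind z ≠ 0}, f z) + π / 3) := rfl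

/-- `cos_μ(0) = 1`: a loop whose interior carries no `f`-mass (interior disjoint from the
support of `f`, or containing all of it when `∫ f = 0`) contributes the factor `1`.
[cite: DuminilCopinKozlowskiLammersManolescu2026, §3.2] -/
theorem nestingFactor_eq_one_of_nestingPhase_eq_zero {f : ℂ → ℝ} {u : UnbasedLoop ℂ}
    (h : u.nestingPhase f = 0) : u.nestingFactor f = 1 := by
  rw [nestingFactor, h, zero_add, Real.cos_pi_div_three]
  norm_num

/-- The weight of the zero density is `1`. [folklore] -/
@[simp] theorem nestingFactor_zero (u : UnbasedLoop ℂ) : u.nestingFactor 0 = 1 :=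
  nestingFactor_eq_one_of_nestingPhase_eq_zero (nestingPhase_zero u)

/-- `|cos_μ(x)| ≤ 1/cos(2πμ) = 2` at `μ = 1/6`. [folklore] -/
theorem abs_nestingFactor_le (f : ℂ → ℝ) (u : UnbasedLoop ℂ) : |u.nestingFactor f| ≤ 2 := by
  rw [nestingFactor, abs_mul, abs_two]
  have := Real.abs_cos_le_one (u.nestingPhase f + π / 3)
  nlinarith

/-- The weight does not depend on the orientation of the loop. [folklore] -/
@[simp] theorem nestingFactor_reverse (f : ℂ → ℝ) (u : UnbasedLoop ℂ) :
    u.reverse.nestingFactor f = u.nestingFactor f := by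
  rw [nestingFactor, nestingFactor, nestingPhase_reverse]

end UnbasedLoop

/-! ### Loops of a typed configuration; truncation to big loops; the loop functional `A_f` -/

namespace LoopConfig

section Loops

variable {E : Type*} [MetricSpace E]

/-- All loops of a typed configuration, both types together: `F₀ ∪ F₁` (DKKMO's
`F = F₀ ⊔ F₁`). [cite: arXiv201211672v2, §1.2] -/
def loops (c : LoopConfig E) : Set (UnbasedLoop E) := c.F 0 ∪ c.F 1

/-- Membership in `loops`. [cite: arXiv201211672v2, §1.2] -/
theorem mem_loops_iff {c : LoopConfig E} {u : UnbasedLoop E} :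
    u ∈ c.loops ↔ u ∈ c.F 0 ∨ u ∈ c.F 1 := Iff.rfl

/-- Every typed family is contained in `loops`. [cite: arXiv201211672v2, §1.2] -/
theorem subset_loops (c : LoopConfig E) (i : Fin 2) : c.F i ⊆ c.loops := by
  intro u hu
  fin_cases i
  · exact Or.inl hu
  · exact Or.inr hu

/-- **The big loops of a configuration**: those of (trace-)diameter at least `ε` — the
configuration-level form of "restrict to large loops" (DKLM §5, p. 37: discard the loops
contained in a ball of radius `ε`) and of the `ε`-ball nesting count of Miller–Watson–Wilson
(Thm. 1.1: the loops surrounding `B(z, ε)`).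
[cite: DuminilCopinKozlowskiLammersManolescu2026, §5 p. 37] -/
def bigLoops (ε : ℝ) (c : LoopConfig E) : Set (UnbasedLoop E) :=
  {u ∈ c.loops | ε ≤ Metric.diam u.range}

/-- Membership in `bigLoops`. [cite: DuminilCopinKozlowskiLammersManolescu2026, §5 p. 37] -/
theorem mem_bigLoops_iff {ε : ℝ} {c : LoopConfig E} {u : UnbasedLoop E} :
    u ∈ c.bigLoops ε ↔ u ∈ c.loops ∧ ε ≤ Metric.diam u.range := Iff.rfl

/-- Big loops are loops. [folklore] -/
theorem bigLoops_subset_loops (ε : ℝ) (c : LoopConfig E) : c.bigLoops ε ⊆ c.loops :=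
  fun _ hu ↦ hu.1

/-- `bigLoops` is antitone in the cut-off: raising `ε` discards loops. [folklore] -/
theorem bigLoops_mono {ε ε' : ℝ} (h : ε ≤ ε') (c : LoopConfig E) :
    c.bigLoops ε' ⊆ c.bigLoops ε :=
  fun _ hu ↦ ⟨hu.1, h.trans hu.2⟩

/-- For `ε ≤ 0` nothing is discarded (diameters are non-negative). [folklore] -/
theorem bigLoops_of_nonpos {ε : ℝ} (h : ε ≤ 0) (c : LoopConfig E) : c.bigLoops ε = c.loops :=
  Set.ext fun _ ↦ ⟨fun hu ↦ hu.1, fun hu ↦ ⟨hu, h.trans Metric.diam_nonneg⟩⟩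

/-- `bigLoops 0 c = c.loops`. [folklore] -/
@[simp] theorem bigLoops_zero (c : LoopConfig E) : c.bigLoops 0 = c.loops :=
  bigLoops_of_nonpos le_rfl c

/-- If every loop of `c` has diameter `≥ ε` (e.g. a lattice loop representation at mesh `≥ ε`),
the truncation at `ε` discards nothing. [folklore] -/
theorem bigLoops_eq_loops_of_le_diam {ε : ℝ} {c : LoopConfig E}
    (h : ∀ u ∈ c.loops, ε ≤ Metric.diam u.range) : c.bigLoops ε = c.loops :=
  Set.ext fun u ↦ ⟨fun hu ↦ hu.1, fun hu ↦ ⟨hu, h u hu⟩⟩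

end Loops

/-- **The truncated loop functional `A^ε_f(c) = ∏_{u ∈ c, diam u ≥ ε} cos_μ(f(int u))`**
(`μ = 1/6`): DKLM's `A_φ(𝓛) = ∏_{ℓ ∈ 𝓛} cos_μ φ(int ℓ)` ((5.4), p. 38) restricted to the big
loops (§5, p. 37). A `finprod`: the honest finite product whenever all but finitely many
factors equal `1` (always the case when `c` has finitely many loops of diameter `≥ ε` meeting
a ball carrying `f`, since `cos_μ(0) = 1`), and the junk value `1` otherwise.
[cite: DuminilCopinKozlowskiLammersManolescu2026, (5.4) and §5 p. 37] -/
def truncNestingWeight (f : ℂ → ℝ) (ε : ℝ) (c : LoopConfig ℂ) : ℝ :=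
  ∏ᶠ u ∈ c.bigLoops ε, u.nestingFactor f

/-- **The loop functional `A_f(c) = ∏_{u ∈ c} cos_μ(f(int u))`** over ALL loops of the
configuration (DKLM (5.4)); on a lattice configuration this is the finite product whose
expectation appears in Cor. 10 and in the consumer route's `MagicFormulaZ2` / `MagicFormulaT`.
[cite: DuminilCopinKozlowskiLammersManolescu2026, (5.4)] -/
def nestingWeight (f : ℂ → ℝ) (c : LoopConfig ℂ) : ℝ := ∏ᶠ u ∈ c.loops, u.nestingFactor f

/-- `A_f` in the literal shape typed by the consumer route (`CardyMagicRigidity`): the `finprod`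
over `F 0 ∪ F 1` of `2 cos((∫ z in {z | W(u,z) ≠ 0}, f z) + π/3)`.
[cite: DuminilCopinKozlowskiLammersManolescu2026, (5.4)] -/
theorem nestingWeight_eq_finprod (f : ℂ → ℝ) (c : LoopConfig ℂ) :
    c.nestingWeight f =
      ∏ᶠ u ∈ c.F 0 ∪ c.F 1, 2 * Real.cos ((∫ z in {z | u.wind z ≠ 0}, f z) + π / 3) :=
  rfl

/-- For `ε ≤ 0` the truncated functional is the full one. [folklore] -/
theorem truncNestingWeight_of_nonpos (f : ℂ → ℝ) {ε : ℝ} (h : ε ≤ 0) (c : LoopConfig ℂ) :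
    c.truncNestingWeight f ε = c.nestingWeight f := by
  rw [truncNestingWeight, bigLoops_of_nonpos h, nestingWeight]

/-- `A^0_f = A_f`. [folklore] -/
@[simp] theorem truncNestingWeight_zero (f : ℂ → ℝ) (c : LoopConfig ℂ) :
    c.truncNestingWeight f 0 = c.nestingWeight f :=
  truncNestingWeight_of_nonpos f le_rfl c

/-- If every loop of `c` has diameter `≥ ε`, then `A^ε_f(c) = A_f(c)`. [folklore] -/
theorem truncNestingWeight_eq_nestingWeight_of_le_diam (f : ℂ → ℝ) {ε : ℝ} {c : LoopConfig ℂ}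
    (h : ∀ u ∈ c.loops, ε ≤ Metric.diam u.range) :
    c.truncNestingWeight f ε = c.nestingWeight f := by
  rw [truncNestingWeight, bigLoops_eq_loops_of_le_diam h, nestingWeight]

/-- The empty configuration has `A^ε_f = 1`. [folklore] -/
@[simp] theorem truncNestingWeight_empty (f : ℂ → ℝ) (ε : ℝ) :
    truncNestingWeight f ε ⟨fun _ ↦ ∅⟩ = 1 := by
  have h : bigLoops ε (⟨fun _ ↦ ∅⟩ : LoopConfig ℂ) = ∅ :=
    Set.eq_empty_of_subset_empty fun u hu ↦ by
      rcases hu.1 with h | h <;> exact h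
  rw [truncNestingWeight, h, finprod_mem_empty]

/-- The zero density has `A^ε_0 = 1`. [folklore] -/
@[simp] theorem truncNestingWeight_zero_density (ε : ℝ) (c : LoopConfig ℂ) :
    c.truncNestingWeight 0 ε = 1 := by
  simp [truncNestingWeight]

end LoopConfig

/-! ### The nesting transform of a law: truncated expectations and their limit `ε → 0⁺` -/

section Law

variable {Ω : Type*} [MeasurableSpace Ω]

/-- **The truncated nesting transform
`Λ^ε_P(f) = E_P[A^ε_f] = E_P[∏_{diam u ≥ ε} 2cos(∫_{int u} f + π/3)]`** of the law of a random
loop configuration `X : Ω → LoopConfig ℂ` under `P` (Bochner integral; junk `0` when the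
truncated weight is not `P`-integrable).
[cite: DuminilCopinKozlowskiLammersManolescu2026, §5 pp. 37–38] -/
def truncNestingTransform (P : Measure Ω) (X : Ω → LoopConfig ℂ) (f : ℂ → ℝ) (ε : ℝ) : ℝ :=
  ∫ ω, (X ω).truncNestingWeight f ε ∂P

/-- At `ε = 0` the truncated transform is the plain expectation
`E_P[A_f] = E_P[∏_{all u} 2cos(∫_{int u} f + π/3)]` — the lattice transform of Cor. 10 and of
the consumer route. [cite: DuminilCopinKozlowskiLammersManolescu2026, Cor. 10] -/
theorem truncNestingTransform_zero (P : Measure Ω) (X : Ω → LoopConfig ℂ) (f : ℂ → ℝ) :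
    truncNestingTransform P X f 0 = ∫ ω, (X ω).nestingWeight f ∂P := by
  simp only [truncNestingTransform, LoopConfig.truncNestingWeight_zero]

/-- If every loop of every configuration `X ω` has diameter `≥ ε`, the truncation at `ε` is
invisible: `Λ^ε_P(f) = E_P[A_f]`. [folklore] -/
theorem truncNestingTransform_eq_of_le_diam (P : Measure Ω) {X : Ω → LoopConfig ℂ}
    (f : ℂ → ℝ) {ε : ℝ} (h : ∀ ω, ∀ u ∈ (X ω).loops, ε ≤ Metric.diam u.range) :
    truncNestingTransform P X f ε = ∫ ω, (X ω).nestingWeight f ∂P := by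
  simp only [truncNestingTransform]
  exact integral_congr_ae (Eventually.of_forall fun ω ↦
    LoopConfig.truncNestingWeight_eq_nestingWeight_of_le_diam f (h ω))

/-- The truncated transform of the zero density is `P(Ω)` (so `1` for a probability law).
[folklore] -/
theorem truncNestingTransform_zero_density (P : Measure Ω) (X : Ω → LoopConfig ℂ) (ε : ℝ) :
    truncNestingTransform P X 0 ε = P.real Set.univ := by
  simp [truncNestingTransform]

/-- **Existence of the nesting transform, as a statement**: the truncated transforms
`Λ^ε_P(f)` converge to `Λ` as the cut-off `ε → 0⁺` (the analogue, for the `cos_μ`-product, of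
the `ε → 0` limit defining the CLE nesting field, Miller–Watson–Wilson Thm. 1.1). This is what
a theorem "the transform of `P` exists" asserts; it is deliberately NOT folded into
`nestingTransform`. [cite: MillerWatsonWilson2015, Thm. 1.1] -/
def HasNestingTransform (P : Measure Ω) (X : Ω → LoopConfig ℂ) (f : ℂ → ℝ) (Λ : ℝ) : Prop :=
  Tendsto (truncNestingTransform P X f) (𝓝[>] 0) (𝓝 Λ)

/-- Unfolding `HasNestingTransform`. [cite: MillerWatsonWilson2015, Thm. 1.1] -/
theorem hasNestingTransform_iff (P : Measure Ω) (X : Ω → LoopConfig ℂ) (f : ℂ → ℝ) (Λ : ℝ) :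
    HasNestingTransform P X f Λ ↔ Tendsto (truncNestingTransform P X f) (𝓝[>] 0) (𝓝 Λ) :=
  Iff.rfl

/-- **The (continuum) nesting transform
`Λ_P(f) := lim_{ε → 0⁺} E_P[∏_{diam u ≥ ε} 2cos(∫_{int u} f + π/3)]`** of the law of the random
loop configuration `X` under `P`: the `limUnder` along `𝓝[>] 0` of the truncated transforms —
the actual limit whenever it exists (`HasNestingTransform.nestingTransform_eq`), an unspecified
real number otherwise. [cite: DuminilCopinKozlowskiLammersManolescu2026, §5 pp. 37–38] -/
def nestingTransform (P : Measure Ω) (X : Ω → LoopConfig ℂ) (f : ℂ → ℝ) : ℝ :=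
  limUnder (𝓝[>] (0 : ℝ)) (truncNestingTransform P X f)

/-- When the limit exists, `nestingTransform` is it. [folklore] -/
theorem HasNestingTransform.nestingTransform_eq {P : Measure Ω} {X : Ω → LoopConfig ℂ}
    {f : ℂ → ℝ} {Λ : ℝ} (h : HasNestingTransform P X f Λ) : nestingTransform P X f = Λ :=
  h.limUnder_eq

/-- The limit, when it exists, is unique. [folklore] -/
theorem HasNestingTransform.unique {P : Measure Ω} {X : Ω → LoopConfig ℂ} {f : ℂ → ℝ}
    {Λ Λ' : ℝ} (h : HasNestingTransform P X f Λ) (h' : HasNestingTransform P X f Λ') :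
    Λ = Λ' :=
  tendsto_nhds_unique h h'

/-- Existence of the limit packaged through `nestingTransform`. [folklore] -/
theorem HasNestingTransform.hasNestingTransform_nestingTransform {P : Measure Ω}
    {X : Ω → LoopConfig ℂ} {f : ℂ → ℝ} {Λ : ℝ} (h : HasNestingTransform P X f Λ) :
    HasNestingTransform P X f (nestingTransform P X f) := by
  rwa [h.nestingTransform_eq]

/-- **Lattice consistency.** If there is `ε₀ > 0` such that every loop of every configuration
`X ω` has diameter `≥ ε₀` — as for any lattice loop representation at positive mesh — then the
truncated transforms are eventually constant, the limit exists, and it is the untruncated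
expectation `E_P[A_f] = E_P[∏_u 2cos(∫_{int u} f + π/3)]`: on lattice laws the continuum
definition returns the lattice transform of Cor. 10 / the consumer route. [folklore] -/
theorem hasNestingTransform_of_le_diam (P : Measure Ω) {X : Ω → LoopConfig ℂ} (f : ℂ → ℝ)
    {ε₀ : ℝ} (hε₀ : 0 < ε₀) (h : ∀ ω, ∀ u ∈ (X ω).loops, ε₀ ≤ Metric.diam u.range) :
    HasNestingTransform P X f (∫ ω, (X ω).nestingWeight f ∂P) := by
  refine (tendsto_const_nhds (x := ∫ ω, (X ω).nestingWeight f ∂P)).congr' ?_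
  filter_upwards [Ioc_mem_nhdsGT hε₀] with ε hε
  exact (truncNestingTransform_eq_of_le_diam P f fun ω u hu ↦ hε.2.trans (h ω u hu)).symm

/-- Under the hypothesis of `hasNestingTransform_of_le_diam`, `Λ_P(f) = E_P[A_f]`. [folklore] -/
theorem nestingTransform_eq_of_le_diam (P : Measure Ω) {X : Ω → LoopConfig ℂ} (f : ℂ → ℝ)
    {ε₀ : ℝ} (hε₀ : 0 < ε₀) (h : ∀ ω, ∀ u ∈ (X ω).loops, ε₀ ≤ Metric.diam u.range) :
    nestingTransform P X f = ∫ ω, (X ω).nestingWeight f ∂P :=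
  (hasNestingTransform_of_le_diam P f hε₀ h).nestingTransform_eq

/-- The transform of the zero density exists and equals `P(Ω)` (`= 1` for a probability law):
`cos_μ(0) = 1` loop by loop. [folklore] -/
theorem hasNestingTransform_zero_density (P : Measure Ω) (X : Ω → LoopConfig ℂ) :
    HasNestingTransform P X 0 (P.real Set.univ) := by
  refine (tendsto_const_nhds (x := P.real Set.univ)).congr' (Eventually.of_forall fun ε ↦ ?_)
  exact (truncNestingTransform_zero_density P X ε).symm

end Law

end Literature.Probability.RandomPlanarGeometry

end
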